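import Mathlib
import Summits.ResolutionOfSingularities.ResolutionOfSingularities.Theorems.WeightedInvariantLocalWeightedDropTOT2CurveSwap

/-!
# `LocalWeightedDrop`, NC count game — TOT2-LINE piece S-CRV (v1.3 (P3)/(B3)): `u₂`-GRAPHS AT THE `u₂`-CHART — F1 conjugated by the swap

[OURS · L1 W4.3 · chain w43, engine crux `LocalWeightedDrop` stmt-ResolutionOfSingularities-8899; piece S-CRV / (P3) = res-type-088; `--supports 8899 --as helper`,
counted 0; definition-free; nothing here is a statement of any manuscript; AI-written (gate-accepted = sorry-free with standard axioms, not refereed).]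

A `u₂`-graph of the label `A` (a top-locus branch `V(y + ψ, u₁ + u₂g(u₂))`, tangent to `V(u₁)` when `g(0) = 0`) is a `u₁`-graph of the swapped label
`Â := (j ↦ A_j(u₂,u₁))`.  By `blowTwoT_eq_swap` the `u₂`-chart of the point move is the `u₁`-chart of `Â`, swapped back; so F1
(`hasGraphCurveT_blowOneT_of_tangent`) transports tangent `u₂`-graphs through the `u₂`-chart with contact ONE LESS — the law behind the term `T₁` of the
conflict budget (a tangent `u₂`-graph of contact `m` becomes transverse after `m − 1` such answers and is then a NEW `u₁`-graph: `…BirthPointExample`).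
* `swap_blowTwoT` — `(blowTwoT d A)^ = blowOneT d Â`;
* **`graph_swap_blowTwoT_of_tangent`** — datum `u₁·g₁` for `Â` ⇒ datum `g₁` for `(blowTwoT d A)^`, re-centring `blowOne 1 ψ`;
* `hasGraphCurveT_swap_blowTwoT_of_tangent` — the predicate form.
-/

set_option linter.dupNamespace false -- mandated namespace of this single-conjunct summit

noncomputable section

namespace Summit.ResolutionOfSingularities.ResolutionOfSingularities.Theorems

namespace TOT2Curve

open MvPowerSeries PolyDescent MonicDescent WildMonic Literature.AlgebraicGeometry.Resolution

variable {k : Type} [Field k] {d : ℕ}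

/-- The swap of the `u₂`-chart label is the `u₁`-chart label of the swapped label. -/
theorem swap_blowTwoT (A : Fin d → MvPowerSeries (Fin 2) k) :
    (fun j => subst (![X 1, X 0] : Fin 2 → MvPowerSeries (Fin 2) k) (blowTwoT d A j)) =
      blowOneT d (fun i => subst (![X 1, X 0] : Fin 2 → MvPowerSeries (Fin 2) k) (A i)) := by
  funext j
  rw [blowTwoT_eq_swap]
  exact subst_swap_subst_swap _

/-- **TANGENT `u₂`-GRAPHS THROUGH THE `u₂`-CHART (F1 conjugated).**  If the swapped label `Â` of the position `A` carries a permissible graph branch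
with tangent datum `u₁·g₁` (a `u₂`-graph of `A` tangent to `V(u₁)`), then the swapped `u₂`-chart label `(blowTwoT d A)^` carries the branch with
datum `g₁`: the contact with `V(u₁)` dropped by one. -/
theorem graph_swap_blowTwoT_of_tangent (hd : 0 < d) (A : Fin d → MvPowerSeries (Fin 2) k) (hA : IsPosT d A)
    (g₁ ψ : MvPowerSeries (Fin 2) k) (hg₁ : ∀ e : Fin 2 →₀ ℕ, e 1 ≠ 0 → coeff e g₁ = 0) (hψ : constantCoeff ψ = 0)
    (hperm : IsPermissibleTwoT d (shift d (shearT (X 0 * g₁) (fun i => subst (![X 1, X 0] : Fin 2 → MvPowerSeries (Fin 2) k) (A i))) ψ)) :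
    constantCoeff (blowOne 1 ψ) = 0 ∧
      IsPermissibleTwoT d (shift d (shearT g₁ (fun j => subst (![X 1, X 0] : Fin 2 → MvPowerSeries (Fin 2) k) (blowTwoT d A j))) (blowOne 1 ψ)) := by
  rw [swap_blowTwoT]
  exact hasGraphCurveT_blowOneT_of_tangent hd _ ((isPosT_swap_iff A).mpr hA) g₁ ψ hg₁ hψ hperm

/-- The predicate form: the swapped `u₂`-chart label has a graph curve. -/
theorem hasGraphCurveT_swap_blowTwoT_of_tangent (hd : 0 < d) (A : Fin d → MvPowerSeries (Fin 2) k) (hA : IsPosT d A)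
    (g₁ ψ : MvPowerSeries (Fin 2) k) (hg₁ : ∀ e : Fin 2 →₀ ℕ, e 1 ≠ 0 → coeff e g₁ = 0) (hψ : constantCoeff ψ = 0)
    (hperm : IsPermissibleTwoT d (shift d (shearT (X 0 * g₁) (fun i => subst (![X 1, X 0] : Fin 2 → MvPowerSeries (Fin 2) k) (A i))) ψ)) :
    HasGraphCurveT d (fun j => subst (![X 1, X 0] : Fin 2 → MvPowerSeries (Fin 2) k) (blowTwoT d A j)) := by
  obtain ⟨h0, hP⟩ := graph_swap_blowTwoT_of_tangent hd A hA g₁ ψ hg₁ hψ hperm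
  exact ⟨g₁, blowOne 1 ψ, hg₁, h0, hP⟩

end TOT2Curve

end Summit.ResolutionOfSingularities.ResolutionOfSingularities.Theorems

end
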